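import Literature.MathematicalPhysics.QuantumLattice.HubbardTTPrimeGrandCanonicalThermalStatesEntropyRow
import Literature.MathematicalPhysics.QuantumLattice.TorusLimitOfMixturesCompactness
import HarnessLib

/-!
# Thermal grand-canonical states of the 2D `t–t'` Hubbard model EXIST, are translation invariant and even; at zero
# pinning field the pair-sourced thermal class is the same class

Family `hubbard` (topic `MathematicalPhysics/QuantumLattice`). Closing bookkeeping for the series
`HubbardTTPrimeGrandCanonical{GibbsMixture,ThermalStates,ThermalStatesEnsembles,ThermalStatesSpinDensities,ThermalStatesKMSRows,
ThermalStatesBogoliubovRows,ThermalStatesKMSMomentRows,ThermalStatesEntropyRow}`: all their theorems quantify over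
«every thermal grand-canonical state», i.e. every torus limit `ω` of the grand-canonical Gibbs mixtures
`(sourcedGibbsCount, gcGibbsWeightTT' β t t' U μ h, gcGibbsVectorTT' t t' U μ h)` along a divergent `Ls`. Here:

* **EXISTENCE** (no vacuity): for all real `β, t, t', U, μ, h` and every `Ls → ∞` such `ω` exist along a subsequence
  (`InfVolFermionState.exists_isTorusLimitOfMixture_gcGibbs`: weak-⋆ compactness, `TorusLimitOfMixturesCompactness`, the
  weights being a probability vector and the components unit vectors), with the divergent side sequence and translation
  invariance / evenness packaged (`exists_isTorusLimitOfMixture_gcGibbs_translationInvariant(_isEven)`);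
* **EVENNESS**: the grand-canonical mixture averages are even (`sum_gcGibbsWeightTT'_mul_torusAvgExpectAt_parityAut`:
  `tr(ρ_L Γ(ΘA)) = tr(Θρ_L · ΓA)` with the even density matrix `gcGibbsDensityTT'` of
  `HubbardTTPrimeGrandCanonicalThermalStatesEntropyRow`), hence every thermal grand-canonical state is EVEN
  (`IsTorusLimitOfMixture.isEven_of_gcGibbs`; the components are not particle-number eigenvectors, so the tree's
  `IsTorusLimitOfMixture.isEven` does not apply directly);
* **THE PAIR-SOURCED CLASS AT ZERO FIELD**: `dWaveSourceTorusTT' L t' U μ 0 = gcTorusHamiltonianTT' L 1 t' U μ 0`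
  (`dWaveSourceTorusTT'_zero_field`), the eigen-data agree on positive sides (`sourcedGibbs{Energy,Vector,Weight}TT'_zero_field`),
  hence along any `Ls → ∞` the thermal classes of `DWaveSourceThermalGibbsTorusLimit` at `h = 0` and of this series at
  `t = 1`, `h = 0` COINCIDE (`isTorusLimitOfMixture_sourcedGibbs_zero_field_iff`): the reference (`h = 0`) thermal states of
  the `T > 0` pairing-response files inherit `0 < ρ(ω) < 2`, the density windows, the brackets and all KMS rows.

Everything is PROVED; no definition, no named fact, no sorry. WHAT THIS IS NOT: uniqueness; anything at `h_pair ≠ 0`.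

## Mathlib / tree search

REUSED: `InfVolFermionState.exists_isTorusLimitOfMixture_subseq` (`TorusLimitOfMixturesCompactness`),
`IsTorusLimitOfMixture.isTranslationInvariant` (`TorusLimitOfMixtures`), `fermionEmbed_parityAut` (`InfVolFermionState`),
`trace_mul_parityAut` (`FermionPartialTrace`), `parityAut_gcGibbsDensityTT'`, `trace_gcGibbsDensityTT'_mul_fermionEmbed_toTorusEmb`
(`…EntropyRow`), `gcGibbsWeightTT'_nonneg`, `sum_gcGibbsWeightTT'`, `star_gcGibbsVectorTT'_dotProduct_self` (`…GibbsMixture`),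
`sourcedGibbs{Energy,Vector}TT'_eq`, `sourcedGibbsWeightTT'` (`DWaveSourceThermalGibbs*`), `eventually_injOn_proj_of_tendsto`.

## References

* O. Bratteli, D. W. Robinson, *Operator Algebras and Quantum Statistical Mechanics I* (1987), Thm. 2.3.15 (weak-⋆
  compactness of the state space), §4.3.1. [cite: BratteliRobinsonI1987, Thm. 2.3.15 (weak-⋆ compactness of the state space) and §4.3.1]
* H. Araki, H. Moriya, Rev. Math. Phys. 15 (2003) 93, §4.1 Def. 4.5 (even states). [cite: ArakiMoriya2003, §4.1 Def. 4.5]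
* T. Koma, H. Tasaki, J. Stat. Phys. 76 (1994) 745, §1 (the sourced model). [cite: KomaTasaki1994, §1]
* R. B. Israel, *Convexity in the Theory of Lattice Gases* (1979), §I.3 eq. (26), Lemma II.3.1. [cite: Israel1979, §I.3 eq. (26)]
-/

noncomputable section

namespace Literature.MathematicalPhysics.QuantumLattice

open Matrix Finset HubbardWave0 Literature.Probability.LatticeModels ThermodynamicLimit LiebThm1
open _root_.Filter
open scoped _root_.Topology ComplexOrder BigOperators

namespace InfVolFermionState

variable (β t t' U μ hz : ℝ)

/-- **Thermal grand-canonical states EXIST along a subsequence of every divergent side sequence**: for all real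
`β, t, t', U, μ, h` and `Ls → ∞` there are a strictly increasing `φ` and an infinite-volume state `ω` with
`ω.IsTorusLimitOfMixture sourcedGibbsCount (gcGibbsWeightTT' β t t' U μ h) (gcGibbsVectorTT' t t' U μ h) (Ls ∘ φ)`
(weak-⋆ compactness: the weights are a probability vector and the components unit vectors) — so no theorem about
«every thermal grand-canonical state» in this series is vacuous. [cite: BratteliRobinsonI1987, Thm. 2.3.15 (weak-⋆ compactness of the state space) and §4.3.1] -/
theorem exists_isTorusLimitOfMixture_gcGibbs {Ls : ℕ → ℕ} (hLs : Tendsto Ls atTop atTop) :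
    ∃ φ : ℕ → ℕ, StrictMono φ ∧ ∃ ω : InfVolFermionState 2,
      ω.IsTorusLimitOfMixture sourcedGibbsCount (gcGibbsWeightTT' β t t' U μ hz) (gcGibbsVectorTT' t t' U μ hz)
        (Ls ∘ φ) :=
  InfVolFermionState.exists_isTorusLimitOfMixture_subseq (gcGibbsWeightTT' β t t' U μ hz) (gcGibbsVectorTT' t t' U μ hz)
    hLs (fun _ i => gcGibbsWeightTT'_nonneg β t t' U μ hz _ i) (fun _ => sum_gcGibbsWeightTT' β t t' U μ hz _)
    (fun _ i => star_gcGibbsVectorTT'_dotProduct_self t t' U μ hz _ i)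

/-- The subsequence of an existence witness still diverges (bookkeeping for the hypotheses `hLs` of the series).
[cite: BratteliRobinsonI1987, §4.3.1 (PDF pp. 373–375)] -/
theorem tendsto_comp_of_strictMono {Ls : ℕ → ℕ} (hLs : Tendsto Ls atTop atTop) {φ : ℕ → ℕ} (hφ : StrictMono φ) :
    Tendsto (Ls ∘ φ) atTop atTop :=
  hLs.comp hφ.tendsto_atTop

/-- **Thermal grand-canonical states exist, are translation invariant, and come with a divergent side sequence**
(the package used by the consumers). [cite: BratteliRobinsonI1987, Thm. 2.3.15 (weak-⋆ compactness of the state space) and §4.3.1] -/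
theorem exists_isTorusLimitOfMixture_gcGibbs_translationInvariant :
    ∃ (Ls : ℕ → ℕ) (ω : InfVolFermionState 2), Tendsto Ls atTop atTop ∧
      ω.IsTorusLimitOfMixture sourcedGibbsCount (gcGibbsWeightTT' β t t' U μ hz) (gcGibbsVectorTT' t t' U μ hz) Ls ∧
        ω.IsTranslationInvariant := by
  obtain ⟨φ, hφ, ω, hω⟩ := exists_isTorusLimitOfMixture_gcGibbs β t t' U μ hz (Ls := id) tendsto_id
  exact ⟨id ∘ φ, ω, tendsto_id.comp hφ.tendsto_atTop, hω, hω.isTranslationInvariant⟩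

/-- **The grand-canonical Gibbs mixture averages are even**: for a region `Λ` fitting into the torus and every
`A ∈ 𝔄_Λ`, `Σ_i p_{L,i} avg_Λ(ΘA) ψ_{L,i} = Σ_i p_{L,i} avg_Λ(A) ψ_{L,i}` (`tr(ρ_L Γ(ΘA)) = tr(Θρ_L · ΓA)` and `ρ_L` is even).
[cite: ArakiMoriya2003, §4.1 Def. 4.5] -/
theorem sum_gcGibbsWeightTT'_mul_torusAvgExpectAt_parityAut (L : ℕ) [NeZero L] {Λ : Finset (Site 2)}
    (hΛ : Set.InjOn (Torus.proj (d := 2) L) ↑Λ) (A : FermionOp Λ) :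
    ∑ i, (gcGibbsWeightTT' β t t' U μ hz L i : ℂ) * torusAvgExpectAt L Λ (parityAut A) (gcGibbsVectorTT' t t' U μ hz L i) =
      ∑ i, (gcGibbsWeightTT' β t t' U μ hz L i : ℂ) * torusAvgExpectAt L Λ A (gcGibbsVectorTT' t t' U μ hz L i) := by
  rw [← trace_gcGibbsDensityTT'_mul_fermionEmbed_toTorusEmb L β t t' U μ hz hΛ,
    ← trace_gcGibbsDensityTT'_mul_fermionEmbed_toTorusEmb L β t t' U μ hz hΛ, fermionEmbed_parityAut,
    trace_mul_parityAut, parityAut_gcGibbsDensityTT']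

/-- **Thermal grand-canonical states are EVEN** (every real `β, t, t', U, μ, h`): `ω(ΘA) = ω(A)` for every local `A`.
[cite: ArakiMoriya2003, §4.1 Def. 4.5] -/
theorem IsTorusLimitOfMixture.isEven_of_gcGibbs {ω : InfVolFermionState 2} {Ls : ℕ → ℕ}
    (hω : ω.IsTorusLimitOfMixture sourcedGibbsCount (gcGibbsWeightTT' β t t' U μ hz)
      (gcGibbsVectorTT' t t' U μ hz) Ls)
    (hLs : Tendsto Ls atTop atTop) : ω.IsEven := by
  intro Λ A
  refine tendsto_nhds_unique (hω Λ (parityAut A)) ((hω Λ A).congr' ?_)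
  filter_upwards [eventually_injOn_proj_of_tendsto Λ hLs, hLs.eventually_ge_atTop 1] with j hInj hj
  haveI : NeZero (Ls j) := ⟨by omega⟩
  simp_rw [torusAvgExpect_eq]
  exact (sum_gcGibbsWeightTT'_mul_torusAvgExpectAt_parityAut β t t' U μ hz (Ls j) hInj A).symm

/-- **Thermal grand-canonical states exist, are translation invariant AND even.**
[cite: BratteliRobinsonI1987, Thm. 2.3.15 (weak-⋆ compactness of the state space) and §4.3.1] -/
theorem exists_isTorusLimitOfMixture_gcGibbs_translationInvariant_isEven :
    ∃ (Ls : ℕ → ℕ) (ω : InfVolFermionState 2), Tendsto Ls atTop atTop ∧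
      ω.IsTorusLimitOfMixture sourcedGibbsCount (gcGibbsWeightTT' β t t' U μ hz) (gcGibbsVectorTT' t t' U μ hz) Ls ∧
        ω.IsTranslationInvariant ∧ ω.IsEven := by
  obtain ⟨Ls, ω, hLs, hω, hTI⟩ := exists_isTorusLimitOfMixture_gcGibbs_translationInvariant β t t' U μ hz
  exact ⟨Ls, ω, hLs, hω, hTI, hω.isEven_of_gcGibbs β t t' U μ hz hLs⟩

end InfVolFermionState

/-! ### The pair-sourced grand-canonical class at zero pinning field is the thermal grand-canonical class at `t = 1` -/

section SourcedBridge

/-- Eigen-data of equal Hermitian matrices agree (the proof argument is a proposition). [folklore] -/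
private theorem sectorEigenvalue_congr {ι : Type*} [Fintype ι] [DecidableEq ι] (p : ι → Prop) [DecidablePred p]
    {A B : Matrix ι ι ℂ} (hA : A.IsHermitian) (hB : B.IsHermitian) (h : A = B) (a : Subtype p) :
    sectorEigenvalue p A hA a = sectorEigenvalue p B hB a := by
  subst h; rfl

/-- Eigenvectors of equal Hermitian matrices agree. [folklore] -/
private theorem sectorEigenvector_congr {ι : Type*} [Fintype ι] [DecidableEq ι] (p : ι → Prop) [DecidablePred p]
    {A B : Matrix ι ι ℂ} (hA : A.IsHermitian) (hB : B.IsHermitian) (h : A = B) (a : Subtype p) :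
    sectorEigenvector p A hA a = sectorEigenvector p B hB a := by
  subst h; rfl

variable (tp U μ : ℝ)

/-- **At zero pinning field the pair-sourced torus is the grand-canonical torus at `t = 1`**:
`dWaveSourceTorusTT' L t' U μ 0 = gcTorusHamiltonianTT' L 1 t' U μ 0`. [cite: KomaTasaki1994, §1] -/
theorem dWaveSourceTorusTT'_zero_field (L : ℕ) [NeZero L] :
    dWaveSourceTorusTT' L tp U μ 0 = gcTorusHamiltonianTT' L 1 tp U μ 0 := by
  rw [dWaveSourceTorusTT', gcTorusHamiltonianTT', Complex.ofReal_zero, zero_smul, zero_smul, sub_zero]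

/-- The mixture energies agree (positive side). [cite: Israel1979, Lemma II.3.1] -/
theorem sourcedGibbsEnergyTT'_zero_field (L : ℕ) [NeZero L] (i : Fin (sourcedGibbsCount L)) :
    sourcedGibbsEnergyTT' tp U μ 0 L i = gcGibbsEnergyTT' 1 tp U μ 0 L i := by
  rw [sourcedGibbsEnergyTT'_eq, gcGibbsEnergyTT']
  exact sectorEigenvalue_congr _ _ _ (dWaveSourceTorusTT'_zero_field tp U μ L) _

/-- The mixture components agree (positive side). [cite: Israel1979, Lemma II.3.1] -/
theorem sourcedGibbsVectorTT'_zero_field (L : ℕ) [NeZero L] (i : Fin (sourcedGibbsCount L)) :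
    sourcedGibbsVectorTT' tp U μ 0 L i = gcGibbsVectorTT' 1 tp U μ 0 L i := by
  rw [sourcedGibbsVectorTT'_eq, gcGibbsVectorTT']
  exact sectorEigenvector_congr _ _ _ (dWaveSourceTorusTT'_zero_field tp U μ L) _

/-- The Gibbs weights agree (positive side). [cite: Israel1979, §I.3 eq. (26)] -/
theorem sourcedGibbsWeightTT'_zero_field (β : ℝ) (L : ℕ) [NeZero L] (i : Fin (sourcedGibbsCount L)) :
    sourcedGibbsWeightTT' β tp U μ 0 L i = gcGibbsWeightTT' β 1 tp U μ 0 L i := by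
  rw [sourcedGibbsWeightTT', gcGibbsWeightTT',
    show sourcedGibbsEnergyTT' tp U μ 0 L = gcGibbsEnergyTT' 1 tp U μ 0 L from
      funext fun i => sourcedGibbsEnergyTT'_zero_field tp U μ L i]

/-- **The torus-limit thermal states of the pair-sourced tori at zero pinning field
(`DWaveSourceThermalGibbsTorusLimit`) are exactly the thermal grand-canonical states at `t = 1`, `h = 0`**
(along any `Ls → ∞`): every theorem of the `HubbardTTPrimeGrandCanonicalThermalStates*` series applies to them
(`0 < ρ(ω) < 2`, the logistic density window, the Griffiths brackets, all KMS row families, the entropy row), and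
conversely the sourced energy–entropy window of that file applies to the grand-canonical class at `t = 1`.
[cite: KomaTasaki1994, §1] [cite: BratteliRobinsonI1987, §4.3.1 (PDF pp. 373–375)] -/
theorem isTorusLimitOfMixture_sourcedGibbs_zero_field_iff (β : ℝ) {ω : InfVolFermionState 2} {Ls : ℕ → ℕ}
    (hLs : Tendsto Ls atTop atTop) :
    ω.IsTorusLimitOfMixture sourcedGibbsCount (sourcedGibbsWeightTT' β tp U μ 0) (sourcedGibbsVectorTT' tp U μ 0) Ls ↔
      ω.IsTorusLimitOfMixture sourcedGibbsCount (gcGibbsWeightTT' β 1 tp U μ 0) (gcGibbsVectorTT' 1 tp U μ 0) Ls := by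
  have heq : ∀ (Λ : Finset (Site 2)) (A : FermionOp Λ), ∀ᶠ j in atTop,
      ∑ i, (sourcedGibbsWeightTT' β tp U μ 0 (Ls j) i : ℂ) * torusAvgExpect (Ls j) Λ A (sourcedGibbsVectorTT' tp U μ 0 (Ls j) i) =
        ∑ i, (gcGibbsWeightTT' β 1 tp U μ 0 (Ls j) i : ℂ) * torusAvgExpect (Ls j) Λ A (gcGibbsVectorTT' 1 tp U μ 0 (Ls j) i) := by
    intro Λ A
    filter_upwards [hLs.eventually_ge_atTop 1] with j hj
    haveI : NeZero (Ls j) := ⟨by omega⟩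
    refine Finset.sum_congr rfl fun i _ => ?_
    rw [sourcedGibbsWeightTT'_zero_field, sourcedGibbsVectorTT'_zero_field]
  constructor
  · intro h Λ A
    exact (h Λ A).congr' (heq Λ A)
  · intro h Λ A
    exact (h Λ A).congr' ((heq Λ A).mono fun j hj => hj.symm)

end SourcedBridge


end Literature.MathematicalPhysics.QuantumLattice

end
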